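import Mathlib
import Summits.Ventures.PercRepro2.MergedUnionPA

/-!
# The merged-cluster positive association for every weight vector over `ℝ`
(blind cell PercRepro2, mine-1 g34)

`merged_union_pa` carries the Doeblin hypothesis `p e < 1` at the edges of `t`.  Over `ℝ` both
sides of the inequality are polynomials in `p` (finite sums of products of the edge factors), so
the hypothesis is removed by continuity: shrink the weights at `t` by the factor `1 − 1/(n+1)`
and let `n → ∞`.  `merged_union_pa_real` is the theorem for every admissible `p : E → ℝ`.
-/

namespace Summit.Ventures.PercRepro2

namespace MergedU

section Continuity

variable {E : Type*} [Fintype E] [DecidableEq E]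

omit [Fintype E] [DecidableEq E] in
/-- `p ↦ edgeFactor (p e) b` is continuous. -/
lemma continuous_edgeFactor (e : E) (b : Bool) :
    Continuous (fun p : E → ℝ => edgeFactor (p e) b) := by
  cases b
  · simp only [edgeFactor_false]
    exact continuous_const.sub (continuous_apply e)
  · simp only [edgeFactor_true]
    exact continuous_apply e

omit [DecidableEq E] in
/-- `p ↦ weight p ω` is continuous. -/
lemma continuous_weight (ω : Config E) : Continuous (fun p : E → ℝ => weight p ω) := by
  show Continuous (fun p : E → ℝ => ∏ e, edgeFactor (p e) (ω e))
  exact continuous_finsetProd _ (fun e _ => continuous_edgeFactor e (ω e))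

/-- `p ↦ expect p f` is continuous. -/
lemma continuous_expect (f : Config E → ℝ) : Continuous (fun p : E → ℝ => expect p f) := by
  show Continuous (fun p : E → ℝ => ∑ ω, weight p ω * f ω)
  exact continuous_finsetSum _ (fun ω _ => (continuous_weight ω).mul continuous_const)

/-- `p ↦ prob p A` is continuous. -/
lemma continuous_prob (A : Set (Config E)) : Continuous (fun p : E → ℝ => prob p A) := by
  simp only [prob_eq_expect_indicator]
  exact continuous_expect _

omit [Fintype E] in
/-- Shrink the weights on the edges of `F` by the factor `1 − 1/(n+1)`. -/
noncomputable def shrink (F : Finset E) (p : E → ℝ) (n : ℕ) : E → ℝ :=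
  fun e => if e ∈ F then (1 - 1 / ((n : ℝ) + 1)) * p e else p e

omit [Fintype E] [DecidableEq E] in
/-- The shrinking factor lies in `[0, 1)`. -/
lemma shrink_factor_mem (n : ℕ) : 0 ≤ 1 - 1 / ((n : ℝ) + 1) ∧ 1 - 1 / ((n : ℝ) + 1) < 1 := by
  have h1 : (0 : ℝ) < (n : ℝ) + 1 := by positivity
  have h2 : 1 / ((n : ℝ) + 1) ≤ 1 := by
    rw [div_le_one h1]
    linarith [(Nat.cast_nonneg n : (0 : ℝ) ≤ n)]
  have h3 : 0 < 1 / ((n : ℝ) + 1) := by positivity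
  constructor <;> linarith

omit [Fintype E] in
/-- Shrinking keeps the weights admissible. -/
lemma shrink_isProbVec {F : Finset E} {p : E → ℝ} (hp : IsProbVec p) (n : ℕ) :
    IsProbVec (shrink F p n) := by
  obtain ⟨hc0, hc1⟩ := shrink_factor_mem n
  refine ⟨fun e => ?_, fun e => ?_⟩ <;> simp only [shrink] <;> split_ifs
  · exact mul_nonneg hc0 (hp.nonneg e)
  · exact hp.nonneg e
  · calc (1 - 1 / ((n : ℝ) + 1)) * p e ≤ 1 * 1 :=
        mul_le_mul hc1.le (hp.le_one e) (hp.nonneg e) zero_le_one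
      _ = 1 := one_mul 1
  · exact hp.le_one e

omit [Fintype E] in
/-- On the edges of `F`, the shrunk weights are `< 1`. -/
lemma shrink_lt_one {F : Finset E} {p : E → ℝ} (hp : IsProbVec p) (n : ℕ) {e : E} (he : e ∈ F) :
    shrink F p n e < 1 := by
  obtain ⟨hc0, hc1⟩ := shrink_factor_mem n
  simp only [shrink, if_pos he]
  calc (1 - 1 / ((n : ℝ) + 1)) * p e ≤ (1 - 1 / ((n : ℝ) + 1)) * 1 :=
      mul_le_mul_of_nonneg_left (hp.le_one e) hc0
    _ = 1 - 1 / ((n : ℝ) + 1) := mul_one _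
    _ < 1 := hc1

omit [Fintype E] in
/-- The shrunk weights converge to `p`. -/
lemma tendsto_shrink (F : Finset E) (p : E → ℝ) :
    Filter.Tendsto (fun n => shrink F p n) Filter.atTop (nhds p) := by
  rw [tendsto_pi_nhds]
  intro e
  simp only [shrink]
  split_ifs with he
  · have h : Filter.Tendsto (fun n : ℕ => (1 - 1 / ((n : ℝ) + 1)) * p e) Filter.atTop
        (nhds ((1 - 0) * p e)) :=
      (tendsto_const_nhds.sub tendsto_one_div_add_atTop_nhds_zero_nat).mul tendsto_const_nhds
    simpa using h
  · exact tendsto_const_nhds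

end Continuity

section Real

variable {V : Type*} {E : Type*} [Fintype E] [DecidableEq E] [Fintype V] [DecidableEq V]
  (ends : E → Sym2 V) (s t : V) (X Y : Set V)

omit [DecidableEq V] in
/-- **Positive association of the merged clusters under the union conditioning, all weights
(over `ℝ`)**: `merged_union_pa` without the Doeblin hypothesis at `t`, by continuity in `p`. -/
theorem merged_union_pa_real {p : E → ℝ} (hp : IsProbVec p) (htY : t ∉ Y)
    {F G : Set V → Set V → ℝ}
    (hF : ∀ ⦃W W' C C' : Set V⦄, W ⊆ W' → C' ⊆ C → F W C ≤ F W' C')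
    (hG : ∀ ⦃W W' C C' : Set V⦄, W ⊆ W' → C' ⊆ C → G W C ≤ G W' C')
    (hF0 : ∀ W C, 0 ≤ F W C) (hG0 : ∀ W C, 0 ≤ G W C) {M : ℝ} (hFM : ∀ W C, F W C ≤ M)
    (hGM : ∀ W C, G W C ≤ M) :
    expect p (fun ω => F (merged ends ω s X Y) (merged ends ω t Y X) *
        ({ω : Config E | t ∉ merged ends ω s X Y}).indicator 1 ω) *
      expect p (fun ω => G (merged ends ω s X Y) (merged ends ω t Y X) *
        ({ω : Config E | t ∉ merged ends ω s X Y}).indicator 1 ω) ≤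
    expect p (fun ω => F (merged ends ω s X Y) (merged ends ω t Y X) *
        G (merged ends ω s X Y) (merged ends ω t Y X) *
        ({ω : Config E | t ∉ merged ends ω s X Y}).indicator 1 ω) *
      prob p {ω : Config E | t ∉ merged ends ω s X Y} := by
  -- the inequality along the shrunk weights
  have key : ∀ n : ℕ,
      expect (shrink (tEdges ends t) p n) (fun ω => F (merged ends ω s X Y) (merged ends ω t Y X) *
          ({ω : Config E | t ∉ merged ends ω s X Y}).indicator 1 ω) *
        expect (shrink (tEdges ends t) p n) (fun ω => G (merged ends ω s X Y) (merged ends ω t Y X) *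
          ({ω : Config E | t ∉ merged ends ω s X Y}).indicator 1 ω) ≤
      expect (shrink (tEdges ends t) p n) (fun ω => F (merged ends ω s X Y) (merged ends ω t Y X) *
          G (merged ends ω s X Y) (merged ends ω t Y X) *
          ({ω : Config E | t ∉ merged ends ω s X Y}).indicator 1 ω) *
        prob (shrink (tEdges ends t) p n) {ω : Config E | t ∉ merged ends ω s X Y} := by
    intro n
    exact merged_union_pa ends s t X Y (shrink_isProbVec hp n) htY
      (fun e he => shrink_lt_one hp n ((mem_tEdges ends t).2 he)) hF hG hF0 hG0 hFM hGM
  -- pass to the limit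
  have hL : Continuous (fun q : E → ℝ =>
      expect q (fun ω => F (merged ends ω s X Y) (merged ends ω t Y X) *
          ({ω : Config E | t ∉ merged ends ω s X Y}).indicator 1 ω) *
        expect q (fun ω => G (merged ends ω s X Y) (merged ends ω t Y X) *
          ({ω : Config E | t ∉ merged ends ω s X Y}).indicator 1 ω)) :=
    (continuous_expect _).mul (continuous_expect _)
  have hR : Continuous (fun q : E → ℝ =>
      expect q (fun ω => F (merged ends ω s X Y) (merged ends ω t Y X) *
          G (merged ends ω s X Y) (merged ends ω t Y X) *
          ({ω : Config E | t ∉ merged ends ω s X Y}).indicator 1 ω) *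
        prob q {ω : Config E | t ∉ merged ends ω s X Y}) :=
    (continuous_expect _).mul (continuous_prob _)
  exact le_of_tendsto_of_tendsto' (b := Filter.atTop)
    ((hL.tendsto p).comp (tendsto_shrink (tEdges ends t) p))
    ((hR.tendsto p).comp (tendsto_shrink (tEdges ends t) p)) key

end Real

end MergedU

end Summit.Ventures.PercRepro2
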